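import Literature.Analysis.FluidPDE.NSLerayHopf
import Literature.Analysis.FluidPDE.LerayHopfProofs
import Literature.Analysis.FluidPDE.SobolevWeakGradient
import HarnessLib

/-!
# The Escauriaza–Seregin–Šverák endpoint `L^∞_t L³_x` — decomposition of `NS.ess_endpoint`

`Literature.Analysis.FluidPDE.NSLerayHopf` records the endpoint regularity/uniqueness theorem
of Escauriaza–Seregin–Šverák (2003) as the named fact `Literature.Analysis.FluidPDE.ess_endpoint` (**ns.S08**):
a Leray–Hopf weak solution of the unforced Cauchy problem on `ℝ³ × [0, T)` lying in
`L^∞(0, T; L³(ℝ³))` is smooth on the open strip `Q_T = (0, T) × ℝ³` and unique among Leray–Hopf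
solutions with the same datum.

The printed proof (ESS 2003, §3, "Proof of Theorem 1.3") has the architecture

* **(1.14)** `v ∈ L^∞_t L³_x` Leray–Hopf ⇒ `v ∈ L₅(Q_T)` — the substance of the paper: local
  Hölder regularity of `L_{3,∞}` suitable weak solutions (their Thm. 1.4, by blow-up around a
  putative singular point, backward uniqueness for the heat operator in a half-space, Thm. 5.1,
  and unique continuation through spatial boundaries, Thm. 4.1), ε-regularity at spatial infinity
  (Lemma 2.2), the multiplicative inequality `‖w‖_{10/3} ≤ C ‖w‖₂^{2/5} ‖∇w‖₂^{3/5}` for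
  `w = |v|^{3/2}` on `(δ, T)`, and Kato's `L³` local theory near `t = 0` (Thm. 7.4);
* **"and hence it is smooth and unique in `Q_T`"** — the Ladyzhenskaya–Prodi–Serrin theorem
  (their Thm. 1.2) in the class `L₅(Q_T) = L⁵_t L⁵_x`, `3/5 + 2/5 = 1`.

This file vendors the first step as the named fact `NS.ess_L5_integrability` and **proves** the
assembly `NS.ess_endpoint_of_L5`: `ess_L5_integrability`, `ladyzhenskaya_prodi_serrin` and
`weak_strong_uniqueness` (both **ns.S07**, already in `NSLerayHopf`) imply `ess_endpoint`.
It also vendors, for the lower layers of the decomposition, the local theorem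
`NS.ess_local_holder` (Thm. 1.4), Kato's `L³` local theory in the form used near `t = 0`
(`NS.ess_kato_L3_local`, Thm. 7.4 / Remark 7.5), and the two linear parabolic theorems on which
Thm. 1.4 rests, in the smooth special case in which §3 of the paper applies them (to the
vorticity of a limit solution all of whose derivatives are bounded, ESS (3.31)–(3.33)):
`NS.ess_backward_uniqueness` (Thm. 5.1) and `NS.ess_unique_continuation` (Thm. 4.1).

## The second layer: `ess_L5_integrability` from (3.6), Kato, and the energy class

The `L₅` integrability (1.14) is in turn **proved** here (`NS.ess_L5_integrability_of`) from

* `NS.ess_sup_bound` — ESS (3.5)–(3.6): a Leray–Hopf solution of the Cauchy problem with datum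
  `a ∈ J̊` and `v ∈ L_{3,∞}(Q_T)` is (essentially) bounded on `ℝ³ × (δ, T)` for every `δ > 0`
  (named fact; this is where Thm. 1.4, the associated pressure (3.2)–(3.4) and Lemma 2.2
  enter, and it is the remaining deep input);
* `NS.ess_kato_L3_local` (Thm. 7.4) and **ns.S07** `weak_strong_uniqueness` — giving
  `v ∈ L₅(Q_{δ₀})` near `t = 0` ("since `a ∈ L₃ ∩ J̊`, we apply Theorem 7.4");
* the elementary interpolation `L^∞_{t,x} ∩ L^∞_t L³_x ⊂ L⁵_{t,x}` on `(δ, T)`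
  (`∫∫ |v|⁵ ≤ C₁(δ)² ∫∫ |v|³`, replacing the multiplicative inequality (3.7), which ESS use to
  the same end) and the gluing of `(0, δ₀)` with `(δ₀/2, T)` (`FluidPDE/LerayHopfProofs`);
* for the datum: ESS (3.1) — `a ∈ L₃` (Fatou along `v(tₙ) → a` in `L₂`, `‖v(tₙ)‖₃ ≤ ‖v‖_{3,∞}`)
  and `a ∈ J̊` (`IsLerayHopfOn.memLp_three_datum`, `isWeaklyDivFree_datum`, `memLp_two_datum`).

**The degenerate datum.** The accepted `Fluid.IsLerayHopfOn T ν 0 u₀ u` constrains the datum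
`u₀ : ℝ³ → ℝ³` only through integrals, so `u₀` may fail to be a.e. strongly measurable, in
which case ESS's standing hypothesis `a ∈ J̊` (1.8) has no counterpart and Thm. 7.4 has no datum
to start from. By `IsLerayHopfOn.aestronglyMeasurable_datum_or` (`LerayHopfProofs`) this only
happens when every pairing `∫ ⟪u₀, w⟫`, `w ∈ L²`, vanishes; then `u` is a weak solution with
datum `0`, lies in `L⁴(Q_T)` (`L^∞_t L³_x ∩ L²_t L⁶_x ⊂ L⁴_{t,x}`, the `L²_t L⁶_x` bound being
the Sobolev embedding of the Leray–Hopf class, ESS (1.11), `NS.lerayHopfClass_L2L6`, proved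
here), and the energy equality for `L⁴(Q_T)` very weak solutions
(`NS.galdi_energy_equality`, Lions 1960 / Galdi 2018, already in `NSLerayHopf`) with datum `0`
forces `u(t) = 0` a.e. for a.e. `t`: such a `u` lies in `L₅(Q_T)` trivially. Hence
`ess_L5_integrability` — and with it `ess_endpoint` (`NS.ess_endpoint_of_sup_bound`) — holds
for every datum admitted by the formal Leray–Hopf predicate, and is reduced to the named facts
`ess_sup_bound`, `ess_kato_L3_local`, `galdi_energy_equality`, `ladyzhenskaya_prodi_serrin`,
`weak_strong_uniqueness`.

## Contents

* `NS.ess_L5_integrability` — ESS 2003, Thm. 1.3, conclusion (1.14) (named fact).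
* `NS.serrin_pair_five` — `2/5 + 3/5 ≤ 1` in `ℝ≥0∞` (the Serrin condition for `q = r = 5`).
* `NS.ess_endpoint_of_L5` — the assembly (real proof).
* `NS.ess_kato_L3_local` — ESS 2003, Thm. 7.4 / Remark 7.5 (Kato's `L³` local theory with the
  `L₅ ∩ L₄` integrability and the Leray–Hopf property; named fact).
* `NS.ess_local_holder` — ESS 2003, Thm. 1.4 (local Hölder regularity in `Q(1/2)`; named fact).
* `NS.ess_backward_uniqueness` — ESS 2003, Thm. 5.1, smooth special case (named fact).
* `NS.ess_unique_continuation` — ESS 2003, Thm. 4.1, smooth special case (named fact).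
* `NS.ess_sup_bound` — ESS 2003, §3, (3.5)–(3.6) (named fact).
* `NS.lerayHopfClass_L2L6` — ESS 2003, (1.11)–(1.12), `s = 6`, `l = 2`; Robinson–Rodrigo–Sadowski
  2016, Thm. 1.7 (i) (named fact, **discharged**: `NS.lerayHopfClass_L2L6_holds`, from the Sobolev
  inequality for weak gradients of `FluidPDE/SobolevWeakGradient` and Tonelli), with the corollaries
  `lerayHopfClass_L2L6.of_isLerayHopfOn`, `NS.memLqLp_two_six_of_isLerayHopfOn`.
* `NS.memLqLp_five_interior_of_ess_sup_bound` — (3.6) ⇒ `v ∈ L₅(Q_{δ,T})` (real proof).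
* `NS.ae_slice_eq_zero_of_datum_zero` — the degenerate datum forces `u ≡ 0` (real proof).
* `NS.exists_memLqLp_five_initial` — `v ∈ L₅(Q_{δ₀})` for some `δ₀ > 0` (real proof).
* `NS.ess_L5_integrability_of`, `NS.ess_endpoint_of_sup_bound` — the assemblies (real proofs).

## Numbering

Theorem and equation numbers are those of the authors' English text of the paper (the version
on G. Seregin's PDMI page, `engESS3.pdf`, whose text is that of Russ. Math. Surveys 58:2 (2003)
211–250): Thm. 1.2 = Ladyzhenskaya–Prodi–Serrin, Thm. 1.3 = the global statement for the
Cauchy problem ((1.13) ⇒ (1.14) "and hence it is smooth and unique in `Q_T`"), Thm. 1.4 = the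
local statement in `Q = B × ]-1, 0[`, Lemma 2.2 = ε-regularity, Thm. 4.1 = unique
continuation, Thm. 5.1 = backward uniqueness, Thm. 7.4 = Kato's theorem. The docstring of
`NS.ess_endpoint` cites "Thms. 1.3–1.4" for the global/local pair.

## Design notes

* Time comes first (`u : ℝ → E → F`), as everywhere in the trunk; ESS write `u(x, t)`.
* `ess_L5_integrability` is stated for every viscosity `ν > 0`, as `ess_endpoint` is; ESS
  normalise `ν = 1` and the general case is the rescaling `w(s, y) = ν⁻¹ u(s/ν, y)`, under which
  the Leray–Hopf class, `L^∞_t L³_x` and `L⁵_t L⁵_x` are invariant. ESS's Leray–Hopf class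
  (1.3)–(1.7) is contained in the accepted `Fluid.IsLerayHopfOn` (which has in addition the
  energy inequality from a.e. `s`), so the vendored hypothesis is the stronger one.
* The two parabolic facts are stated for jointly `C²` fields on the open region with the
  differential inequality pointwise, continuity up to the initial slice, and ESS's integrability
  hypotheses (5.4) / (4.1) kept verbatim as finiteness of lower Lebesgue integrals; ESS prove
  them for `W^{2,1}_2` fields with the inequality a.e., so the vendored statements are special
  cases. ESS work with the *backward* heat operator `∂ₜ + Δ` ("this will save us writing some
  minus signs"), and so do we.

## References

* L. Escauriaza, G. Seregin, V. Šverák, *`L_{3,∞}`-solutions of Navier–Stokes equations and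
  backward uniqueness*, Uspekhi Mat. Nauk 58:2 (2003) 3–44 = Russ. Math. Surveys 58:2 (2003)
  211–250, Thms. 1.2, 1.3 ((1.13)–(1.14)), 1.4, Lemma 2.2, §3, Thm. 4.1, Thm. 5.1, Thm. 7.4.
* J. C. Robinson, J. L. Rodrigo, W. Sadowski, *The three-dimensional Navier–Stokes equations*
  (CUP 2016), Thm. 16.4 and §16.4, pp. 247–251 (sketch of the same architecture: Steps 1–4).
* G. Seregin, *Lecture notes on regularity theory for the Navier–Stokes equations* (World
  Scientific 2014), Thm. 6.21 (backward uniqueness), Appendix A.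
* J. C. Robinson, J. L. Rodrigo, W. Sadowski, op. cit., Thm. 1.7 (i) (Sobolev embedding
  `W₀^{1,p} ⊂ L^{p*}`, `W₀^{1,p}(ℝⁿ) = W^{1,p}(ℝⁿ)`), Thm. 1.5 and Lemma 3.5 (Lebesgue
  interpolation; `L²(0, T; L⁶)` for the Leray–Hopf class, p. 60).
* G. P. Galdi, *On the energy equality for distributional solutions to Navier–Stokes equations*,
  Proc. AMS 147 (2019), Thm. 1.1 (vendored as `NS.galdi_energy_equality` in `NSLerayHopf`).
-/

noncomputable section

open MeasureTheory TopologicalSpace Set Function Filter Topology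
open scoped InnerProductSpace RealInnerProductSpace ENNReal NNReal Laplacian

namespace Literature.Analysis.FluidPDE

/-- Local notation for physical space `ℝ³ = EuclideanSpace ℝ (Fin 3)`. -/
local notation "ℝ³" => EuclideanSpace ℝ (Fin 3)

/-! ### ESS Theorem 1.3, (1.14): `L^∞_t L³_x` Leray–Hopf solutions lie in `L₅(Q_T)` -/

/-- **Escauriaza–Seregin–Šverák, the `L₅` integrability** (ESS 2003, Thm. 1.3, conclusion
(1.14); proof in §3 from Thm. 1.4, Lemma 2.2, (3.6)–(3.7) and Thm. 7.4). Let `ν > 0` and let `u`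
be a Leray–Hopf weak solution of the unforced Cauchy problem on `ℝ³ × [0, T)` with
`u ∈ L_{3,∞}(Q_T) = L^∞(0, T; L³(ℝ³))` (ESS (1.13)). Then `u ∈ L₅(Q_T) = L⁵(0, T; L⁵(ℝ³))`
(ESS (1.14)) — the Ladyzhenskaya–Prodi–Serrin class with `s = l = 5`, from which "it is smooth
and unique in `Q_T`" (ESS Thm. 1.2). ESS take `ν = 1`; the general case is the Navier–Stokes
rescaling `w(s, y) = ν⁻¹ u(s/ν, y)`, which preserves all three classes. [cite: EscauriazaSereginSverak2003, Thm. 1.3 (1.14)] -/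
def ess_L5_integrability : Prop :=
  ∀ {ν T : ℝ} (_hν : 0 < ν) (_hT : 0 < T) {u₀ : ℝ³ → ℝ³} {u : ℝ → ℝ³ → ℝ³}
    (_hu : FluidPDE.IsLerayHopfOn T ν 0 u₀ u) (_h₃ : FluidPDE.MemLqLp ∞ 3 u (Ioo 0 T)),
    FluidPDE.MemLqLp 5 5 u (Ioo 0 T)

/-- The Serrin condition `2/q + 3/r ≤ 1` for the pair `q = r = 5` (with equality:
`2/5 + 3/5 = 1`; ESS 2003, (1.10) with `s = l = 5`). [cite: EscauriazaSereginSverak2003, (1.10)] -/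
theorem serrin_pair_five : (2 : ℝ≥0∞) / 5 + 3 / 5 ≤ 1 := by
  rw [ENNReal.div_add_div_same, show (2 : ℝ≥0∞) + 3 = 5 by norm_num,
    ENNReal.div_self (by norm_num) (by norm_num)]

/-- `3 < 5` in `ℝ≥0∞` (the spatial exponent `r = 5` is admissible in **ns.S07**). [folklore] -/
theorem three_lt_five_ennreal : (3 : ℝ≥0∞) < 5 := by
  norm_num

/-- **Assembly of `NS.ess_endpoint`** (ESS 2003, §3, end of the proof of Thm. 1.3: "(1.14) and
hence it is smooth and unique in `Q_T`", via Thm. 1.2 = Ladyzhenskaya–Prodi–Serrin with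
`s = l = 5`). Given the `L₅` integrability `ess_L5_integrability`, LPS regularity
`ladyzhenskaya_prodi_serrin` yields a classical solution `(v, p)` on `(0, T]` agreeing with `u`
slice-wise a.e., which restricts to the open strip `(0, T)` (`Fluid.IsClassicalNSSolutionOn.mono`
with `uniqueDiffOn_Ioo`: the one-sided time derivative within `Ioc 0 T` and within `Ioo 0 T`
agree at interior times), and `weak_strong_uniqueness` in the class `L⁵_t L⁵_x` gives uniqueness
among Leray–Hopf solutions with the same datum on `(0, T]`. Real proof. [cite: EscauriazaSereginSverak2003, §3, proof of Thm. 1.3] -/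
theorem ess_endpoint_of_L5 (hL5 : ess_L5_integrability) (hLPS : ladyzhenskaya_prodi_serrin)
    (hWS : weak_strong_uniqueness) : ess_endpoint := by
  intro ν T hν hT u₀ u hu h₃
  have h5 : FluidPDE.MemLqLp 5 5 u (Ioo 0 T) := hL5 hν hT hu h₃
  refine ⟨?_, fun v hv => hWS hν hT hu three_lt_five_ennreal serrin_pair_five h5 hv⟩
  obtain ⟨v, p, hcl, hae⟩ := hLPS hν hT hu three_lt_five_ennreal serrin_pair_five h5
  exact ⟨v, p, hcl.mono Ioo_subset_Ioc_self (uniqueDiffOn_Ioo 0 T),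
    fun t ht => hae t (Ioo_subset_Ioc_self ht)⟩

/-! ### ESS Theorem 7.4: Kato's `L³` local theory in the form used in §3 -/

/-- **Short-time solvability with datum in `L₃ ∩ J̊`** (ESS 2003, Appendix, Thm. 7.4 with
Remark 7.5; due to T. Kato, Math. Z. 187 (1984)). Let `ν > 0` and let the datum `a` lie in
`L₃ ∩ J̊` (square integrable, weakly divergence free, and in `L³`; ESS (7.14)). Then there is
`T⋆ > 0`, depending on `a` only, and a solution `u` of the unforced Cauchy problem on `[0, T⋆]`
with `u ∈ C([0, T⋆]; L₂) ∩ L₂(0, T⋆; J̊¹₂)` (7.30), `u ∈ C([0, T⋆]; L₃) ∩ L₅(Q_{T⋆}) ∩ L₄(Q_{T⋆})`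
(7.31), which "is in fact the weak Leray–Hopf solution" (Remark 7.5). Vendored as: a Leray–Hopf
weak solution on `[0, T⋆)` with datum `a` (accepted `Fluid.IsLerayHopfOn`) which is continuous
into `L³` on `[0, T⋆]` and lies in `L⁵_t L⁵_x ∩ L⁴_t L⁴_x` on `(0, T⋆)`; the pressure clauses
(7.32) and uniqueness in the class are not restated (uniqueness among Leray–Hopf solutions is
**ns.S07** `weak_strong_uniqueness` with `q = r = 5`, as in Remark 7.5). ESS take `ν = 1`
(rescaling as for `ess_L5_integrability`). This is the ingredient giving `v ∈ L₅(Q_{δ₀})` near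
`t = 0` in the proof of Thm. 1.3. [cite: EscauriazaSereginSverak2003, Thm. 7.4, Remark 7.5] -/
def ess_kato_L3_local : Prop :=
  ∀ {ν : ℝ} (_hν : 0 < ν) {a : ℝ³ → ℝ³} (_h₂ : MemLp a 2 volume) (_h₃ : MemLp a 3 volume)
    (_hdiv : FluidPDE.IsWeaklyDivFree a),
    ∃ T : ℝ, 0 < T ∧ ∃ u : ℝ → ℝ³ → ℝ³, FluidPDE.IsLerayHopfOn T ν 0 a u ∧
      FluidPDE.ContinuousInLpOn (Icc 0 T) 3 u ∧ FluidPDE.MemLqLp 5 5 u (Ioo 0 T) ∧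
      FluidPDE.MemLqLp 4 4 u (Ioo 0 T)

/-! ### ESS Theorem 1.4: local Hölder regularity of `L_{3,∞}` solutions -/

/-- **Escauriaza–Seregin–Šverák, the local theorem** (ESS 2003, Thm. 1.4). Let `v`, `p` be
defined on the space–time cylinder `Q = B × ]-1, 0[`, `B = B(1) ⊂ ℝ³` (the accepted backward
parabolic cylinder `Fluid.parabolicCylinder 1 (0, 0)`, time first), satisfy the Navier–Stokes
equations (`ν = 1`, no force) in `Q` in the sense of distributions, and have the differentiability
properties (1.15): `v ∈ L_{2,∞}(Q) ∩ L₂(-1, 0; W¹₂(B))` (the gradient being a weak spatial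
gradient `G` on `Q`, accepted `Fluid.HasWeakSpatialGradientOn`), `p ∈ L_{3/2}(Q)`. If in
addition (1.16) `‖v‖_{3,∞,Q} = ess sup_{-1<t<0} ‖v(·, t)‖_{L³(B)} < ∞`, then `v` is Hölder
continuous in the closure of `Q(1/2) = B(1/2) × ]-(1/2)², 0[`: the a.e.-defined field `v` has a
representative `w` on `ℝ × ℝ³` which is Hölder continuous (some exponent `α > 0`) on the closure
of `Q(1/2)` and agrees with `v` a.e. on `Q(1/2)`. [cite: EscauriazaSereginSverak2003, Thm. 1.4] -/
def ess_local_holder : Prop :=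
  ∀ (v : ℝ → ℝ³ → ℝ³) (p : ℝ → ℝ³ → ℝ),
    FluidPDE.IsDistributionalNSSolutionOn (FluidPDE.parabolicCylinderOpens 1 ((0 : ℝ), (0 : ℝ³))) 1 0
      v p →
    (∃ C : ℝ≥0, ∀ᵐ t ∂(volume.restrict (Ioo (-1) 0)),
      ∫⁻ x in Metric.ball (0 : ℝ³) 1, ‖v t x‖ₑ ^ 2 ≤ C) →
    (∃ G : ℝ → ℝ³ → ℝ³ →L[ℝ] ℝ³,
      FluidPDE.HasWeakSpatialGradientOn (FluidPDE.parabolicCylinderOpens 1 ((0 : ℝ), (0 : ℝ³))) v G ∧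
      ∫⁻ z in FluidPDE.parabolicCylinder 1 ((0 : ℝ), (0 : ℝ³)),
        ENNReal.ofReal (FluidPDE.frobeniusNormSq (G z.1 z.2)) < ∞) →
    (∫⁻ z in FluidPDE.parabolicCylinder 1 ((0 : ℝ), (0 : ℝ³)), ‖p z.1 z.2‖ₑ ^ (3 / 2 : ℝ) < ∞) →
    (∃ C : ℝ≥0, ∀ᵐ t ∂(volume.restrict (Ioo (-1) 0)),
      ∫⁻ x in Metric.ball (0 : ℝ³) 1, ‖v t x‖ₑ ^ 3 ≤ C) →
    ∃ (w : ℝ × ℝ³ → ℝ³) (C α : ℝ≥0), 0 < α ∧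
      HolderOnWith C α w (closure (FluidPDE.parabolicCylinder (1 / 2) ((0 : ℝ), (0 : ℝ³)))) ∧
      uncurry v =ᵐ[volume.restrict (FluidPDE.parabolicCylinder (1 / 2) ((0 : ℝ), (0 : ℝ³)))] w

/-! ### ESS Theorem 5.1: backward uniqueness for the heat operator in a half-space -/

/-- **Backward uniqueness for the heat operator in a half-space** (ESS 2003, Thm. 5.1; also
Escauriaza–Seregin–Šverák, Arch. Ration. Mech. Anal. 169 (2003); Seregin 2014, Thm. 6.21),
*smooth special case*. Let `ℝⁿ₊ = {x | 0 < ⟪x, e⟫}` be an open half-space of `ℝⁿ` (`e` a unit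
vector; ESS take `e = eₙ`) and `Q₊ = ℝⁿ₊ × ]0, 1[`. Let `u : Q₊ → ℝᵐ` be jointly `C²` on `Q₊`
and continuous up to the initial slice `t = 0`, with (5.4) `u`, `∂ₜu`, `∇²u` square integrable
over bounded (measurable) subsets of `Q₊`, and suppose
(5.1) `|∂ₜu + Δu| ≤ c₁ (|∇u| + |u|)` in `Q₊` (backward heat operator with variable lower-order
terms), (5.3) `|u(x, t)| ≤ e^{M|x|²}` in `Q₊`, and (5.2) `u(·, 0) = 0` in `ℝⁿ₊`.
Then `u ≡ 0` in `Q₊`. No assumption is made on `u` at the boundary `⟪x, e⟫ = 0`. ESS prove this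
for `u` with the Sobolev regularity (5.4) only and (5.1) a.e.; the `C²` version (the one applied
in ESS §3, (3.32)–(3.35), to the vorticity of a limit solution with bounded derivatives) is a
special case. Time first: `u : ℝ → ℝⁿ → ℝᵐ`. [cite: EscauriazaSereginSverak2003, Thm. 5.1] -/
def ess_backward_uniqueness : Prop :=
  ∀ (n m : ℕ) (e : EuclideanSpace ℝ (Fin n)) (_he : ‖e‖ = 1)
    (u : ℝ → EuclideanSpace ℝ (Fin n) → EuclideanSpace ℝ (Fin m)) (c₁ M : ℝ),
    ContDiffOn ℝ 2 (uncurry u) (Ioo 0 1 ×ˢ {x | 0 < ⟪x, e⟫_ℝ}) →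
    ContinuousOn (uncurry u) (Ico 0 1 ×ˢ {x | 0 < ⟪x, e⟫_ℝ}) →
    (∀ K ⊆ Ioo (0 : ℝ) 1 ×ˢ {x : EuclideanSpace ℝ (Fin n) | 0 < ⟪x, e⟫_ℝ},
      Bornology.IsBounded K → MeasurableSet K →
      ∫⁻ z in K, (‖u z.1 z.2‖ₑ ^ 2 + ‖FluidPDE.timeDeriv u z.1 z.2‖ₑ ^ 2 +
        ‖iteratedFDeriv ℝ 2 (u z.1) z.2‖ₑ ^ 2) < ∞) →
    (∀ t ∈ Ioo (0 : ℝ) 1, ∀ x, 0 < ⟪x, e⟫_ℝ →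
      ‖FluidPDE.timeDeriv u t x + Δ (u t) x‖ ≤ c₁ * (‖fderiv ℝ (u t) x‖ + ‖u t x‖)) →
    (∀ t ∈ Ioo (0 : ℝ) 1, ∀ x, 0 < ⟪x, e⟫_ℝ → ‖u t x‖ ≤ Real.exp (M * ‖x‖ ^ 2)) →
    (∀ x, 0 < ⟪x, e⟫_ℝ → u 0 x = 0) →
    ∀ t ∈ Ioo (0 : ℝ) 1, ∀ x, 0 < ⟪x, e⟫_ℝ → u t x = 0

/-! ### ESS Theorem 4.1: unique continuation through spatial boundaries -/

/-- **Unique continuation through spatial boundaries** (ESS 2003, Thm. 4.1; cf.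
Escauriaza–Fernández), *smooth special case*. In the space–time cylinder
`Q(R, T) = B(R) × ]0, T[ ⊂ ℝ³ × ℝ` let `u : Q(R, T) → ℝᵐ` be jointly `C²`, continuous up to the
slice `t = 0`, with (4.1) `u ∈ W^{2,1}_2(Q(R, T))`, i.e.
`|u| + |∇u| + |∇²u| + |∂ₜu| ∈ L₂(Q(R, T))`, (4.2) `|∂ₜu + Δu| ≤ c₁ (|u| + |∇u|)` in `Q(R, T)`,
and (4.3) `|u(x, t)| ≤ C_k (|x| + √t)^k` on `Q(R, T)` for every `k = 0, 1, …` (the origin is a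
zero of infinite order). Then `u(x, 0) = 0` for all `x ∈ B(R)`. ESS assume only (4.1) with (4.2)
a.e.; the `C²` version (applied in ESS §3 to the vorticity on `B(4R) × ]t₀ + ε, t₀ + δ₀ - ε[`) is
a special case. Time first: `u : ℝ → ℝ³ → ℝᵐ`. [cite: EscauriazaSereginSverak2003, Thm. 4.1] -/
def ess_unique_continuation : Prop :=
  ∀ (m : ℕ) (R T : ℝ) (_hR : 0 < R) (_hT : 0 < T) (u : ℝ → ℝ³ → EuclideanSpace ℝ (Fin m))
    (c₁ : ℝ),
    ContDiffOn ℝ 2 (uncurry u) (Ioo 0 T ×ˢ Metric.ball (0 : ℝ³) R) →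
    ContinuousOn (uncurry u) (Ico 0 T ×ˢ Metric.ball (0 : ℝ³) R) →
    (∫⁻ z in Ioo 0 T ×ˢ Metric.ball (0 : ℝ³) R, (‖u z.1 z.2‖ₑ ^ 2 +
        ‖fderiv ℝ (u z.1) z.2‖ₑ ^ 2 + ‖iteratedFDeriv ℝ 2 (u z.1) z.2‖ₑ ^ 2 +
        ‖FluidPDE.timeDeriv u z.1 z.2‖ₑ ^ 2) < ∞) →
    (∀ t ∈ Ioo 0 T, ∀ x ∈ Metric.ball (0 : ℝ³) R,
      ‖FluidPDE.timeDeriv u t x + Δ (u t) x‖ ≤ c₁ * (‖u t x‖ + ‖fderiv ℝ (u t) x‖)) →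
    (∀ k : ℕ, ∃ C : ℝ, ∀ t ∈ Ioo 0 T, ∀ x ∈ Metric.ball (0 : ℝ³) R,
      ‖u t x‖ ≤ C * (‖x‖ + Real.sqrt t) ^ k) →
    ∀ x ∈ Metric.ball (0 : ℝ³) R, u 0 x = 0

/-! ### ESS (3.5)–(3.6): boundedness away from the initial time -/

/-- **Escauriaza–Seregin–Šverák, boundedness away from `t = 0`** (ESS 2003, §3, proof of
Thm. 1.3, (3.5)–(3.6)). Let `ν > 0`, let the datum `a` lie in `J̊` (square integrable and weakly
divergence free: ESS (1.8), the standing hypothesis on the datum of the Cauchy problem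
(1.1)–(1.2)), and let `u` be a Leray–Hopf weak solution of the unforced Cauchy problem on
`ℝ³ × [0, T)` with datum `a` and `u ∈ L_{3,∞}(Q_T)` (1.13). Then for every `δ ∈ (0, T)` the
field is bounded on `ℝ³ × [δ, T]`: (3.6) `max_{z ∈ ℝ³ × [δ, T]} |v(z)| < C₁(δ) < +∞` for the
Hölder continuous representative `v` of (3.5) — from Thm. 1.4 by scaling around every
`z₀ ∈ ℝ³ × ]0, T]`, the associated pressure (3.2)–(3.4), and ε-regularity (Lemma 2.2) as
`|z₀| → ∞`. Rendering for the a.e.-defined field: `u ∈ L^∞(δ, T; L^∞(ℝ³))` (accepted guarded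
mixed class `Fluid.MemLqLp ∞ ∞ u (Ioo δ T)`), which is (3.6) up to the representative. ESS take
`ν = 1`; the general case is the rescaling `w(s, y) = ν⁻¹ u(s/ν, y)` as for
`ess_L5_integrability`. [cite: EscauriazaSereginSverak2003, §3 (3.5)–(3.6)] -/
def ess_sup_bound : Prop :=
  ∀ {ν T : ℝ} (_hν : 0 < ν) (_hT : 0 < T) {u₀ : ℝ³ → ℝ³} {u : ℝ → ℝ³ → ℝ³}
    (_hu₀ : MemLp u₀ 2 volume) (_hdiv : FluidPDE.IsWeaklyDivFree u₀)
    (_hu : FluidPDE.IsLerayHopfOn T ν 0 u₀ u) (_h₃ : FluidPDE.MemLqLp ∞ 3 u (Ioo 0 T)),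
    ∀ δ ∈ Ioo 0 T, FluidPDE.MemLqLp ∞ ∞ u (Ioo δ T)

/-! ### ESS (1.11): the Leray–Hopf class lies in `L²_t L⁶_x` -/

/-- **The Leray–Hopf class embeds in `L²(0, T; L⁶(ℝ³))`** (Escauriaza–Seregin–Šverák 2003,
(1.11)–(1.12) with `s = 6`, `l = 2`: "by standard imbeddings, functions of the Leray–Hopf class
satisfy `v ∈ L_{s,l}(Q_T)` with `3/s + 2/l = 3/2`, `s ∈ [2, 6]`"; the imbedding is the Sobolev
inequality `‖u‖_{L⁶(ℝ³)} ≤ c ‖∇u‖_{L²(ℝ³)}` for `u ∈ W₀^{1,2}(ℝ³) = W^{1,2}(ℝ³)`,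
Robinson–Rodrigo–Sadowski 2016, Thm. 1.7 (i), applied slice-wise — ibid. p. 60: "from the
definition of a weak solution and the Sobolev embedding `H¹ ⊂ L⁶` it follows that a weak
solution `u` belongs to the space `L²(0, T; L⁶)`"). Rendering: a time-dependent field on
`ℝ³ × (0, T)` in the function class (1.3) of the accepted `Fluid.IsLerayHopfOn` — jointly a.e.
strongly measurable, slices in `L²` with `L^∞_t L²_x` bound, weakly divergence free for a.e. `t`,
and a weak gradient `G t` of `u t` for a.e. `t` with `∫₀ᵀ ∫ |G|² < ∞` — lies in the guarded mixed
class `L²(0, T; L⁶(ℝ³))`. [cite: EscauriazaSereginSverak2003, (1.11)–(1.12)] [cite: RobinsonRodrigoSadowski2016, Thm. 1.7] -/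
def lerayHopfClass_L2L6 : Prop :=
  ∀ {T : ℝ} {u : ℝ → ℝ³ → ℝ³} (G : ℝ → ℝ³ → ℝ³ →L[ℝ] ℝ³),
    AEStronglyMeasurable (uncurry u) (volume.restrict (Ioo 0 T ×ˢ univ)) →
    (∀ t ∈ Icc 0 T, MemLp (u t) 2 volume) →
    (∃ C : ℝ≥0, ∀ᵐ t ∂(volume.restrict (Ioo 0 T)), FluidPDE.eEnergy (u t) ≤ C) →
    (∀ᵐ t ∂(volume.restrict (Ioo 0 T)), FluidPDE.IsWeaklyDivFree (u t)) →
    (∀ᵐ t ∂(volume.restrict (Ioo 0 T)), FluidPDE.HasWeakGradient (u t) (G t)) →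
    (∫⁻ t in Ioo 0 T, ∫⁻ x, ENNReal.ofReal (FluidPDE.frobeniusNormSq (G t x)) < ∞) →
    FluidPDE.MemLqLp 2 6 u (Ioo 0 T)

variable {ν T : ℝ} {f : ℝ → ℝ³ → ℝ³} {u₀ : ℝ³ → ℝ³} {u : ℝ → ℝ³ → ℝ³}

/-- A Leray–Hopf weak solution on `ℝ³ × [0, T)` lies in `L²(0, T; L⁶(ℝ³))`, given the imbedding
`lerayHopfClass_L2L6` of its function class (Escauriaza–Seregin–Šverák 2003, (1.11);
Robinson–Rodrigo–Sadowski 2016, p. 60). Real proof (projection of the fields of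
`Fluid.IsLerayHopfOn`). [cite: EscauriazaSereginSverak2003, (1.11)–(1.12)] -/
theorem lerayHopfClass_L2L6.of_isLerayHopfOn (h26 : lerayHopfClass_L2L6)
    (hu : FluidPDE.IsLerayHopfOn T ν f u₀ u) : FluidPDE.MemLqLp 2 6 u (Ioo 0 T) := by
  obtain ⟨G, hG, hGint, -, -⟩ := hu.weakGrad_energy
  exact h26 G hu.weak.1 hu.memLp hu.energy_bound hu.weak.ae_isWeaklyDivFree hG hGint

/-- **Discharge of `lerayHopfClass_L2L6`** (Escauriaza–Seregin–Šverák 2003, (1.11)–(1.12),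
`s = 6`, `l = 2`; Robinson–Rodrigo–Sadowski 2016, Thm. 1.7 (i) and p. 60). Slice-wise, the
Sobolev inequality for weakly differentiable fields
(`Fluid.eLpNorm_six_le_lintegral_frobeniusNormSq_weakGradient`, `FluidPDE/SobolevWeakGradient`,
proved by mollification) gives `‖u(t)‖₆² ≤ K² ∫ |G(t)|²` for a.e. `t ∈ (0, T)`; integrating,
`∫₀ᵀ ‖u(t)‖₆² ≤ K² ∫₀ᵀ ∫ |G|² < ∞`. The guard `u(t) ∈ L⁶` for a.e. `t` needs the a.e. finiteness
of `t ↦ ‖u(t)‖₆²`, which follows from the finiteness of its integral because this function is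
a.e. measurable — by Tonelli (`AEMeasurable.lintegral_prod_right'`) from the joint measurability
of `u` on `(0, T) × ℝ³`. Real proof. [cite: EscauriazaSereginSverak2003, (1.11)–(1.12)] -/
theorem lerayHopfClass_L2L6_holds : lerayHopfClass_L2L6 := by
  intro T u G hmeas hL2 _hbound _hdiv hG hGint
  set K : ℝ≥0 := SNormLESNormFDerivOfEqConst ℝ³ (volume : Measure ℝ³) 2 with hK
  set D : ℝ → ℝ≥0∞ := fun t => ∫⁻ x, ENNReal.ofReal (FluidPDE.frobeniusNormSq (G t x)) with hD
  have hE : Module.finrank ℝ ℝ³ = 3 := by simp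
  -- slice-wise Sobolev inequality, squared: `‖u t‖₆² ≤ K² D t` for a.e. `t ∈ (0, T)`
  have hslice : ∀ᵐ t ∂(volume.restrict (Ioo 0 T)),
      eLpNorm (u t) 6 volume ^ 2 ≤ (K : ℝ≥0∞) ^ 2 * D t := by
    filter_upwards [hG, ae_restrict_mem measurableSet_Ioo] with t ht htI
    have h := FluidPDE.eLpNorm_six_le_lintegral_frobeniusNormSq_weakGradient hE ht
      (hL2 t (Ioo_subset_Icc_self htI)).eLpNorm_lt_top
    calc eLpNorm (u t) 6 volume ^ 2 ≤ ((K : ℝ≥0∞) * D t ^ (1 / 2 : ℝ)) ^ 2 := by gcongr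
      _ = (K : ℝ≥0∞) ^ 2 * D t := by
        rw [mul_pow, ← ENNReal.rpow_natCast (D t ^ (1 / 2 : ℝ)) 2, ← ENNReal.rpow_mul]
        norm_num
  -- measurability in time of `t ↦ ‖u t‖₆` (Tonelli)
  have hprod : (volume.restrict (Ioo 0 T ×ˢ (univ : Set ℝ³)) : Measure (ℝ × ℝ³)) =
      (volume.restrict (Ioo (0 : ℝ) T)).prod (volume : Measure ℝ³) := by
    rw [Measure.volume_eq_prod, ← Measure.restrict_univ (μ := (volume : Measure ℝ³)),
      Measure.prod_restrict, Measure.restrict_univ]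
  have hF : AEMeasurable (fun t => eLpNorm (u t) 6 volume ^ 2) (volume.restrict (Ioo 0 T)) := by
    have h6 : AEMeasurable (fun t => ∫⁻ x, ‖uncurry u (t, x)‖ₑ ^ (6 : ℝ) ∂volume)
        (volume.restrict (Ioo 0 T)) := by
      have hm : AEMeasurable (fun z : ℝ × ℝ³ => ‖uncurry u z‖ₑ ^ (6 : ℝ))
          ((volume.restrict (Ioo (0 : ℝ) T)).prod (volume : Measure ℝ³)) := by
        rw [← hprod]
        exact (hmeas.aemeasurable.enorm.pow_const _)
      exact hm.lintegral_prod_right'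
    have heq : (fun t => eLpNorm (u t) 6 volume ^ 2) =
        fun t => ((∫⁻ x, ‖uncurry u (t, x)‖ₑ ^ (6 : ℝ) ∂volume) ^ (1 / (6 : ℝ))) ^ 2 := by
      funext t
      rw [eLpNorm_eq_lintegral_rpow_enorm_toReal (by norm_num) (by norm_num)]
      simp [uncurry]
    rw [heq]
    exact (h6.pow_const _).pow_const _
  -- `∫⁻ ‖u t‖₆² ≤ K² ∫⁻ D < ∞`
  have hint : ∫⁻ t in Ioo 0 T, eLpNorm (u t) 6 volume ^ 2 < ∞ := by
    refine lt_of_le_of_lt (lintegral_mono_ae hslice) ?_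
    rw [lintegral_const_mul' _ _ (ENNReal.pow_ne_top ENNReal.coe_ne_top)]
    exact ENNReal.mul_lt_top (ENNReal.pow_lt_top ENNReal.coe_lt_top) hGint
  -- (i) slices in `L⁶` a.e.
  have hfin : ∀ᵐ t ∂(volume.restrict (Ioo 0 T)), eLpNorm (u t) 6 volume ^ 2 < ∞ :=
    ae_lt_top' hF hint.ne
  refine ⟨?_, ?_⟩
  · filter_upwards [hfin, ae_restrict_mem measurableSet_Ioo] with t ht htI
    exact ⟨(hL2 t (Ioo_subset_Icc_self htI)).1,
      (ENNReal.pow_lt_top_iff.1 ht).resolve_right two_ne_zero⟩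
  · -- (ii) `eLqLpNorm 2 6 u (0, T) < ∞`
    rw [FluidPDE.eLqLpNorm]
    have h2 := FluidPDE.eLpNorm_natCast_pow_eq_lintegral (volume.restrict (Ioo 0 T))
      (fun t => (eLpNorm (u t) 6 volume).toReal) (n := 2) two_ne_zero
    simp only [Nat.cast_ofNat] at h2
    have hle : ∫⁻ t in Ioo 0 T, ‖(eLpNorm (u t) 6 volume).toReal‖ₑ ^ 2 ≤
        ∫⁻ t in Ioo 0 T, eLpNorm (u t) 6 volume ^ 2 := by
      refine lintegral_mono fun t => ?_
      gcongr
      rw [Real.enorm_eq_ofReal ENNReal.toReal_nonneg]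
      exact ENNReal.ofReal_toReal_le
    have hsq : eLpNorm (fun t => (eLpNorm (u t) 6 volume).toReal) 2
        (volume.restrict (Ioo 0 T)) ^ 2 < ∞ := by
      rw [h2]; exact lt_of_le_of_lt hle hint
    exact (ENNReal.pow_lt_top_iff.1 hsq).resolve_right two_ne_zero

/-- A Leray–Hopf weak solution on `ℝ³ × [0, T)` lies in `L²(0, T; L⁶(ℝ³))`
(Escauriaza–Seregin–Šverák 2003, (1.11); Robinson–Rodrigo–Sadowski 2016, p. 60). Real proof. [cite: EscauriazaSereginSverak2003, (1.11)–(1.12)] -/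
theorem memLqLp_two_six_of_isLerayHopfOn (hu : FluidPDE.IsLerayHopfOn T ν f u₀ u) :
    FluidPDE.MemLqLp 2 6 u (Ioo 0 T) :=
  lerayHopfClass_L2L6_holds.of_isLerayHopfOn hu

/-! ### ESS §3: (3.6) ⇒ `v ∈ L₅(Q_{δ,T})` -/

/-- **From (3.6) to `v ∈ L₅(Q_{δ,T})`** (ESS 2003, §3: "we deduce `v ∈ L₅(Q_{δ,T})` for any
`δ > 0`"). Given `ess_sup_bound`, a Leray–Hopf solution with datum in `J̊` and
`u ∈ L^∞(0, T; L³)` lies in `L⁵(δ, T; L⁵)` for every `δ ∈ (0, T)`: on the finite time set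
`(δ, T)`, `‖u(t)‖₅⁵ ≤ ‖u(t)‖_∞² ‖u(t)‖₃³ ≤ C₁(δ)² ‖u‖_{3,∞}³` for a.e. `t`
(`Fluid.MemLqLp.five_of_top_top_of_top_three`; ESS reach the same conclusion through the
multiplicative inequality (3.7) for `w = |v|^{3/2}`). Real proof. [cite: EscauriazaSereginSverak2003, §3, proof of Thm. 1.3] -/
theorem memLqLp_five_interior_of_ess_sup_bound (h36 : ess_sup_bound) (hν : 0 < ν) (hT : 0 < T)
    (hu₀ : MemLp u₀ 2 volume) (hdiv : FluidPDE.IsWeaklyDivFree u₀)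
    (hu : FluidPDE.IsLerayHopfOn T ν 0 u₀ u) (h₃ : FluidPDE.MemLqLp ∞ 3 u (Ioo 0 T)) {δ : ℝ}
    (hδ : δ ∈ Ioo 0 T) : FluidPDE.MemLqLp 5 5 u (Ioo δ T) :=
  (h36 hν hT hu₀ hdiv hu h₃ δ hδ).five_of_top_top_of_top_three
    (h₃.mono_set (Ioo_subset_Ioo_left hδ.1.le))
    (by rw [Real.volume_Ioo]; exact ENNReal.ofReal_ne_top)

/-! ### The degenerate datum: `u ≡ 0` -/

/-- **A Leray–Hopf solution in `L^∞_t L³_x` whose datum functional vanishes is zero.** If every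
pairing `∫ ⟪u₀, w⟫`, `w ∈ L²`, vanishes (the degenerate branch of
`Fluid.IsLerayHopfOn.aestronglyMeasurable_datum_or`, possible only for a non-measurable
`u₀`), then `u` is a weak solution with datum `0` (`isWeakNSSolutionOn_zero_datum`), it lies in
`L⁴(0, T; L⁴)` (`L^∞_t L³_x ∩ L²_t L⁶_x`, `Fluid.MemLqLp.four_of_top_three_of_two_six`, with
`lerayHopfClass_L2L6`), and the energy equality for `L⁴(Q_T)` very weak solutions
(`galdi_energy_equality`, with the datum `0 ∈ L²_σ`) gives `½‖u(t)‖₂² + ν ∫₀ᵗ ‖∇u‖₂² = 0`,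
whence `u(t) = 0` a.e. in space for a.e. `t ∈ (0, T)`. Real proof. [cite: Galdi2018, Thm 1.1] -/
theorem ae_slice_eq_zero_of_datum_zero (hG : galdi_energy_equality)
    (hν : 0 < ν) (hT : 0 < T) (hu : FluidPDE.IsLerayHopfOn T ν 0 u₀ u)
    (h₃ : FluidPDE.MemLqLp ∞ 3 u (Ioo 0 T))
    (h0 : ∀ w : ℝ³ → ℝ³, MemLp w 2 volume → ∫ x, ⟪u₀ x, w x⟫ = 0) :
    ∀ᵐ t ∂(volume.restrict (Ioo 0 T)), u t =ᵐ[volume] 0 := by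
  have hw0 : FluidPDE.IsWeakNSSolutionOn T ν 0 0 u := hu.isWeakNSSolutionOn_zero_datum h0
  have h₄ : FluidPDE.MemLqLp 4 4 u (Ioo 0 T) :=
    h₃.four_of_top_three_of_two_six (memLqLp_two_six_of_isLerayHopfOn hu)
  have hdiv0 : FluidPDE.IsWeaklyDivFree (0 : ℝ³ → ℝ³) := fun θ _ => by simp
  obtain ⟨-, G, -, -, hEq⟩ := hG hν hT (MemLp.zero' (ε := ℝ³)) hdiv0 hw0 h₄
  have hK0 : VectorCalculus.kineticEnergy (fun _ : ℝ³ => (0 : ℝ³)) = 0 := by simp [VectorCalculus.kineticEnergy]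
  filter_upwards [hEq, ae_restrict_mem measurableSet_Ioo] with t ht htI
  replace ht : VectorCalculus.kineticEnergy (u t) + ν * (∫⁻ τ in Ioo 0 t, ∫⁻ x,
      ENNReal.ofReal (FluidPDE.frobeniusNormSq (G τ x))).toReal = 0 := ht.trans hK0
  have hut : MemLp (u t) 2 volume := hu.memLp t (Ioo_subset_Icc_self htI)
  have hnn : 0 ≤ ν * (∫⁻ τ in Ioo 0 t, ∫⁻ x,
      ENNReal.ofReal (FluidPDE.frobeniusNormSq (G τ x))).toReal := by positivity
  have hE0 : VectorCalculus.kineticEnergy (u t) = 0 :=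
    le_antisymm (by linarith [FluidPDE.kineticEnergy_nonneg (u t)]) (FluidPDE.kineticEnergy_nonneg _)
  have hint : ∫ x, ‖u t x‖ ^ 2 = 0 := by
    have := hE0
    rw [VectorCalculus.kineticEnergy] at this
    simpa using this
  have hsq : (fun x => ‖u t x‖ ^ 2) =ᵐ[volume] 0 :=
    (integral_eq_zero_iff_of_nonneg (fun x => sq_nonneg _)
      ((memLp_two_iff_integrable_sq_norm hut.1).1 hut)).1 hint
  filter_upwards [hsq] with x hx
  simpa using hx

/-! ### ESS §3: `v ∈ L₅(Q_{δ₀})` near the initial time -/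

/-- **`L₅` near `t = 0`** (ESS 2003, §3, end of the proof of Thm. 1.3: "since `a ∈ L₃ ∩ J̊`
(this is the necessary condition following from (3.1)), we apply Theorem 7.4 and conclude that
`v ∈ L₅(Q_{δ₀})` for some `δ₀ > 0`"). For a Leray–Hopf solution of the unforced Cauchy problem
on `ℝ³ × [0, T)` with `u ∈ L^∞(0, T; L³)` there is `δ₀ ∈ (0, T]` with `u ∈ L⁵(0, δ₀; L⁵)`.
Honest branch (`u₀` a.e. strongly measurable): `u₀ ∈ L² ∩ L³` and weakly divergence free
(`IsLerayHopfOn.memLp_two_datum`, `memLp_three_datum` = ESS (3.1), `isWeaklyDivFree_datum`),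
Kato's theorem `ess_kato_L3_local` (Thm. 7.4) gives a Leray–Hopf solution `U ∈ L⁵_t L⁵_x` on
`[0, T₁)` with the same datum, and weak–strong uniqueness (**ns.S07**, `q = r = 5`; ESS
Remark 7.5) identifies `u` with `U` slice-wise on `(0, min T T₁]`, both restricted by
`Fluid.IsLerayHopfOn.of_le`. Degenerate branch: `u ≡ 0` (`ae_slice_eq_zero_of_datum_zero`).
Real proof. [cite: EscauriazaSereginSverak2003, §3, proof of Thm. 1.3] -/
theorem exists_memLqLp_five_initial (hK : ess_kato_L3_local) (hWS : weak_strong_uniqueness)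
    (hG : galdi_energy_equality) (hν : 0 < ν) (hT : 0 < T)
    (hu : FluidPDE.IsLerayHopfOn T ν 0 u₀ u) (h₃ : FluidPDE.MemLqLp ∞ 3 u (Ioo 0 T)) :
    ∃ δ₀ ∈ Ioc 0 T, FluidPDE.MemLqLp 5 5 u (Ioo 0 δ₀) := by
  rcases hu.aestronglyMeasurable_datum_or hT with hm | h0
  · -- honest branch: `u₀ ∈ L² ∩ L³`, weakly divergence free; Kato + weak–strong uniqueness
    have hu₀2 : MemLp u₀ 2 volume := hu.memLp_two_datum hT hm
    have hu₀3 : MemLp u₀ 3 volume := hu.memLp_three_datum hT hm h₃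
    have hdiv : FluidPDE.IsWeaklyDivFree u₀ := hu.isWeaklyDivFree_datum hT
    obtain ⟨T₁, hT₁, U, hU, -, hU5, -⟩ := hK hν hu₀2 hu₀3 hdiv
    have hT₂pos : 0 < min T T₁ := lt_min hT hT₁
    have hu' : FluidPDE.IsLerayHopfOn (min T T₁) ν 0 u₀ u := hu.of_le (min_le_left _ _)
    have hU' : FluidPDE.IsLerayHopfOn (min T T₁) ν 0 u₀ U := hU.of_le (min_le_right _ _)
    have hU5' : FluidPDE.MemLqLp 5 5 U (Ioo 0 (min T T₁)) :=
      hU5.mono_set (Ioo_subset_Ioo_right (min_le_right _ _))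
    have hae := hWS hν hT₂pos hU' three_lt_five_ennreal serrin_pair_five hU5' hu'
    refine ⟨min T T₁, ⟨hT₂pos, min_le_left _ _⟩, hU5'.congr_ae_slice ?_⟩
    exact (ae_restrict_iff' measurableSet_Ioo).2 (Eventually.of_forall fun t ht =>
      hae t (Ioo_subset_Ioc_self ht))
  · -- degenerate branch: `u ≡ 0`
    exact ⟨T, ⟨hT, le_rfl⟩, FluidPDE.memLqLp_of_ae_slice_eq_zero
      (ae_slice_eq_zero_of_datum_zero hG hν hT hu h₃ h0)⟩

/-! ### Assembly of (1.14) and of `ess_endpoint` -/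

/-- **ESS Theorem 1.3, (1.14), from the second-layer facts** (ESS 2003, §3, proof of Thm. 1.3).
`ess_sup_bound` ((3.5)–(3.6)), `ess_kato_L3_local` (Thm. 7.4), **ns.S07**
`weak_strong_uniqueness`, `galdi_energy_equality` and `lerayHopfClass_L2L6` ((1.11)) imply
`ess_L5_integrability`: in the honest branch (datum a.e. strongly measurable, hence in `J̊`)
`u ∈ L⁵(0, δ₀; L⁵)` near `t = 0` (`exists_memLqLp_five_initial`) and `u ∈ L⁵(δ₀/2, T; L⁵)`
away from it (`memLqLp_five_interior_of_ess_sup_bound`), glued by `Fluid.MemLqLp.union`; in the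
degenerate branch `u ≡ 0`. Real proof. [cite: EscauriazaSereginSverak2003, §3, proof of Thm. 1.3] -/
theorem ess_L5_integrability_of (h36 : ess_sup_bound) (hK : ess_kato_L3_local)
    (hWS : weak_strong_uniqueness) (hG : galdi_energy_equality) : ess_L5_integrability := by
  intro ν T hν hT u₀ u hu h₃
  rcases hu.aestronglyMeasurable_datum_or hT with hm | h0
  · have hu₀2 : MemLp u₀ 2 volume := hu.memLp_two_datum hT hm
    have hdiv : FluidPDE.IsWeaklyDivFree u₀ := hu.isWeaklyDivFree_datum hT
    obtain ⟨δ₀, hδ₀, h5⟩ := exists_memLqLp_five_initial hK hWS hG hν hT hu h₃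
    have hδ : δ₀ / 2 ∈ Ioo 0 T := ⟨by linarith [hδ₀.1], by linarith [hδ₀.2]⟩
    have h5' := memLqLp_five_interior_of_ess_sup_bound h36 hν hT hu₀2 hdiv hu h₃ hδ
    refine (h5.union h5').mono_set fun t ht => ?_
    by_cases hlt : t < δ₀
    · exact Or.inl ⟨ht.1, hlt⟩
    · exact Or.inr ⟨by linarith [hδ₀.1, not_lt.1 hlt], ht.2⟩
  · exact FluidPDE.memLqLp_of_ae_slice_eq_zero (ae_slice_eq_zero_of_datum_zero hG hν hT hu h₃ h0)

/-- **`NS.ess_endpoint` from the second-layer facts** (ESS 2003, Thm. 1.3 with §3):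
`ess_sup_bound`, `ess_kato_L3_local`, `weak_strong_uniqueness`, `galdi_energy_equality`,
`lerayHopfClass_L2L6` and `ladyzhenskaya_prodi_serrin` imply the endpoint regularity and
uniqueness theorem **ns.S08** (`ess_L5_integrability_of` followed by `ess_endpoint_of_L5`).
Real proof. [cite: EscauriazaSereginSverak2003, Thm. 1.3] -/
theorem ess_endpoint_of_sup_bound (h36 : ess_sup_bound) (hK : ess_kato_L3_local)
    (hWS : weak_strong_uniqueness) (hG : galdi_energy_equality)
    (hLPS : ladyzhenskaya_prodi_serrin) : ess_endpoint :=
  ess_endpoint_of_L5 (ess_L5_integrability_of h36 hK hWS hG) hLPS hWS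

end Literature.Analysis.FluidPDE
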